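import Summits.QuantumFields.BalabanUV.Beta.EriceRemainderEnclosureHistoryAutonomyComparisonAgeCompositionReadMonotone
import Summits.QuantumFields.BalabanUV.Beta.EriceRemainderEnclosureHistoryAutonomyComparisonAgeCompositionOneLagDecayFlow

/-!
# EriceRemainderEnclosureHistoryAutonomyComparisonAgeCompositionCriteriaFlow — (E81d) THE TWO CRITERIA ON THE FLOW: shift domination of the flow's lone
# kernels is automatic, so their cumulative domination IS row-mass monotonicity; the age-1 row mass is non-increasing along every box solution ((E81b)); with
# older ages the youngest age's MONO″ follows from KEY₁ and a growth bound of the old surplus; and route (N)'s first-order END for the flow now stands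
# MODULO TWO STATIC-TYPE FAMILIES — «row masses of the ages ≥ 2 do not increase with the pin» and «the young reads of old surpluses decay per pin by the
# shift-domination defect» — in place of (E80f)'s MONOa ∧ MONO″

Cell `pub-balaban`, β-function sub-cell, BINDER row D4 «RemainderConst leaves for Bałaban's split» (`HOME/BINDER-OWNERS.md`; owner lineage `b2b-balaban-beta-an4`;
this file by co-owner #2 lineage `b2b-balaban-beta-d4-p2`, generation 72), β-FLOW TEAM duty (1), FREEZE (0) honoured (def-free; imports (E81c)
`…ReadMonotone`, (E81b) `…OneLagDecayFlow`; uses (E75a) `weight_nonneg`∕`weight_eq_zero_of_horizon`∕`defect_nonneg`∕`persistence`∕`defect_mono`, (E80e)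
`exists_static_chain`∕`age_chain_closes`, (E81a) `young_drops_antitone_of_read_decay`, (E81b) `kernel_one_lag_decay`, (E81c) `cum_dom_of_window`∕
`nonneg_of_chain_closes_of_read_decay` BY NAME; nothing restated).

HONEST FRAMING (page 1, verbatim and binding).  *"Discharging BetaPertH makes Bałaban's UV stability UNCONDITIONAL — a real constructive-QFT result; it is
NOT the continuum limit and NOT the Clay problem."*  THIS FILE DISCHARGES NOTHING OF THE KIND.  Elementary real analysis about ABSTRACT functionals on a box
]0,γ]^ℕ with displayed floors, profiles and signs, and the FIRST-ORDER renewal objects of route (N) built from them — hypotheses of a census, not facts; the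
form, signs, ages and moments of Bałaban's (1.22) limit functional are NOT PRINTED ([I] p. 298; GAPS G-t4-U2-1∕-2) and NOT asserted.  Row D4 class
UNCHANGED (critical-path width 0; instance 0∕1; D4 DISCHARGE NO DATE).  HONEST DEPENDENCY: continuum YM on T⁴ ⇐ BetaPertH ∧ nine spine estimates (0/9
proved); BetaPertH ⇐ (D1) ∧ (D4) ∧ CAP+tail; G-an2-4 gates asym, D1 and NE2/3/4.

THE POINT (census sense (α); route (N); README `g72/e81/README.md`).  §1 **`flow_shift_domination`**: the flow's lone kernel `KL k n l = c_{n,k}Π_{t=n+1+l}^{n+k}g_t`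
(`c_{n,k} = L_kh_{n+k}³∕2` non-increasing in the pin, dampings `≤ 1`) satisfies `KL k (n+1) l ≤ KL k n (l+1)` inside the window — the next row at lag `l` is the
current row at lag `l+1` times `(c_{n+1,k}∕c_{n,k})·g_{n+k+1} ≤ 1`.  Hence (§2 `flow_cum_dom_of_rowmass`, by (E81c) `cum_dom_of_window`) cumulative domination
of `KL k` — what MONOa needs — IS «the damped row mass `x̃^k_n = Σ_l KL k n l` does not increase with the pin `n`»; §3 `flow_rowmass_one`: true for the age
`1` along every box solution ((E81b) `kernel_one_lag_decay`).  §4 **`flow_mono2_youngest_of_growth`**: with older ages present, MONO″ for the youngest age `1`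
⟸ KEY₁ ∧ «the old surplus grows per pin no faster than the one-lag decay ratio», `Kk_{n+1}(1+Kk_n)·v_{n+2} ≤ Kk_n·v_{n+1}` ((E81a) with `U = RL 1 v`; the
shift-domination defect of a one-lag kernel is `Kk_n`).  §5 **`flow_nonneg_of_criteria`**: (E80f) `flow_nonneg_of_mono2` with `hMONOa` ∧ `hMONO2` REPLACED
by (a) `hrow`: for every age `2 ≤ k < K`, `x̃^k_{n+1} ≤ x̃^k_n` at every pin, and (b) `hdecay`: for every age `i`, admissible `w`, GIVEN `v = SA (i+1) w ≥ 0`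
and KEY_i, the read-decay inequality `M i n·A (n+1) ≤ A n − A (n+1)` for `A = RL i v` ((E81c) `nonneg_of_chain_closes_of_read_decay` on the flow's chain,
closed by (E80c)∕(E80e)).  NUMERICS OF RECORD: (a) holds in every damping class tested (`g72/numerics/m13.py`, `m14.py`; ratios 0.970–0.9994) BUT for an
old age `k` under a saturated youngest age at the pin the leading orders cancel (window-sum growth `(1+C)∕k` against kernel decay `1∕k` plus entering
damping `C∕k` in the pure power-law model) and an adversarial RELAXED damping (`g_{n+k+1} = 1`, heavy window) violates it by `≈ 0.08 %` at `k = 300`: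
(a) is a theorem about self-consistent ∕ lower-envelope ∕ absent damping, NOT about the relaxed class — README §3 gives the robust hybrid criterion
(`x̃^k_{n+1} − x̃^k_n ≤ KL k n 0·(1∕Θ_n − 1)`, `Θ_n` = decay of the young drops across the old window) for far old ages; (b) holds with ratio `≤ 0.68` on
every multi-age profile tested (`m11.py`).  NOT CLAIMED: (a) for ages `≥ 2` or (b) for the flow; anything nonlinear; anything printed.

WHAT IS PROVED ([folklore]; 0 `def`, 0 sorry).  §1 **`flow_shift_domination`**.  §2 `flow_cum_dom_of_rowmass`.  §3 `flow_rowmass_one`.  §4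
**`flow_mono2_youngest_of_growth`**.  §5 **`flow_nonneg_of_criteria`**.
-/
noncomputable section
open Finset

namespace Summit.QuantumFields.BalabanUV.Beta.EriceRemainderEnclosureHistoryAutonomyComparisonAgeCompositionCriteriaFlow

open Literature.MathematicalPhysics.QuantumFieldTheory.Balaban1983to89
open Literature.MathematicalPhysics.QuantumFieldTheory.Balaban1983to89.T4BetaStationary
open Literature.MathematicalPhysics.QuantumFieldTheory.Balaban1983to89.T4BetaFlowWellPosed
open Summit.QuantumFields.BalabanUV.Beta.EriceRemainderEnclosureHistoryAutonomyOrder (strictAnti_of_memFlow)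
open Summit.QuantumFields.BalabanUV.Beta.EriceRemainderEnclosureHistoryAutonomyComparisonAgeComposition
open Summit.QuantumFields.BalabanUV.Beta.EriceRemainderEnclosureHistoryAutonomyComparisonAgeCompositionIdentification
open Summit.QuantumFields.BalabanUV.Beta.EriceRemainderEnclosureHistoryAutonomyComparisonAgeCompositionChainWiringAtPin
open Summit.QuantumFields.BalabanUV.Beta.EriceRemainderEnclosureHistoryAutonomyComparisonAgeCompositionReadDecay
open Summit.QuantumFields.BalabanUV.Beta.EriceRemainderEnclosureHistoryAutonomyComparisonAgeCompositionReadMonotone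
open Summit.QuantumFields.BalabanUV.Beta.EriceRemainderEnclosureHistoryAutonomyComparisonAgeCompositionOneLagDecayFlow

variable {B : (ℕ → ℝ) → ℝ} {γ b gIR : ℝ} {L : ℕ → ℝ} {K : ℕ} {h g : ℕ → ℝ} {KL : ℕ → ℕ → ℕ → ℝ}

/-! ## §1 Shift domination of the flow's lone kernels -/

/-- **SHIFT DOMINATION INSIDE THE WINDOW (automatic).**  For the flow's lone kernels `KL k n l = [0<k<K][l<k]·(L_kh_{n+k}³∕2)·Π_{t=n+1+l}^{n+k} g_t` along a
positive non-increasing `h` with dampings `0 < g ≤ 1`: `KL k (n+1) l ≤ KL k n (l+1)` whenever `l + 1 < k`. [folklore] -/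
theorem flow_shift_domination (hL : ∀ k, 0 ≤ L k) (hh0 : ∀ n, 0 < h n) (hanti : Antitone h) (hg : ∀ t, 0 < g t ∧ g t ≤ 1)
    (hKL : ∀ k n l, KL k n l = if 0 < k ∧ k < K ∧ l < k then L k * h (n + k) ^ 3 / 2 * ∏ t ∈ Ico (n + 1 + l) (n + k + 1), g t else 0)
    (k n l : ℕ) (hl : l + 1 < k) : KL k (n + 1) l ≤ KL k n (l + 1) := by
  rw [hKL, hKL]
  by_cases hk : 0 < k ∧ k < K
  · rw [if_pos ⟨hk.1, hk.2, by omega⟩, if_pos ⟨hk.1, hk.2, hl⟩, show n + 1 + 1 + l = n + 1 + (l + 1) by ring,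
      show n + 1 + k + 1 = n + k + 1 + 1 by ring, prod_Ico_succ_top (by omega)]
    have hP : 0 ≤ ∏ t ∈ Ico (n + 1 + (l + 1)) (n + k + 1), g t := (prod_damping_pos hg _).le
    have hc : L k * h (n + 1 + k) ^ 3 / 2 ≤ L k * h (n + k) ^ 3 / 2 := by
      have := pow_le_pow_left₀ (hh0 _).le (hanti (by omega : n + k ≤ n + 1 + k)) 3
      have := hL k
      nlinarith
    have hc0 : 0 ≤ L k * h (n + 1 + k) ^ 3 / 2 := by have := hL k; have := hh0 (n + 1 + k); positivity
    calc L k * h (n + 1 + k) ^ 3 / 2 * ((∏ t ∈ Ico (n + 1 + (l + 1)) (n + k + 1), g t) * g (n + k + 1))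
        ≤ L k * h (n + 1 + k) ^ 3 / 2 * ((∏ t ∈ Ico (n + 1 + (l + 1)) (n + k + 1), g t) * 1) := by
          gcongr; exact (hg _).2
      _ ≤ L k * h (n + k) ^ 3 / 2 * ∏ t ∈ Ico (n + 1 + (l + 1)) (n + k + 1), g t := by
          rw [mul_one]; exact mul_le_mul_of_nonneg_right hc hP
  · rw [if_neg (fun h3 => hk ⟨h3.1, h3.2.1⟩), if_neg (fun h3 => hk ⟨h3.1, h3.2.1⟩)]

/-! ## §2 Cumulative domination of a lone kernel = its row mass does not increase with the pin -/

/-- For the flow's lone kernel of the age `k` (`1 ≤ k < K`): row mass non-increasing in the pin ⟹ cumulative domination. [folklore] -/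
theorem flow_cum_dom_of_rowmass (hL : ∀ k, 0 ≤ L k) (hh0 : ∀ n, 0 < h n) (hanti : Antitone h) (hg : ∀ t, 0 < g t ∧ g t ≤ 1)
    (hKL : ∀ k n l, KL k n l = if 0 < k ∧ k < K ∧ l < k then L k * h (n + k) ^ 3 / 2 * ∏ t ∈ Ico (n + 1 + l) (n + k + 1), g t else 0)
    {k : ℕ} (hrow : ∀ n, ∑ l ∈ range k, KL k (n + 1) l ≤ ∑ l ∈ range k, KL k n l) (n M : ℕ) :
    ∑ l ∈ range (M + 1), KL k (n + 1) l ≤ ∑ l ∈ range (M + 2), KL k n l :=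
  cum_dom_of_window (weight_nonneg hL hh0 hg hKL k) (fun n l hl => by rw [hKL, if_neg (fun h3 => by omega)])
    (fun n l hl => flow_shift_domination hL hh0 hanti hg hKL k n l hl) hrow n M

/-! ## §3 The age 1: row mass non-increasing along every box solution -/

/-- The row mass of the age `1` is its one-lag kernel and does not increase with the pin ((E81b) `kernel_one_lag_decay`). [folklore] -/
theorem flow_rowmass_one (hmono : ∀ u v : ℕ → ℝ, SeqBox γ u → SeqBox γ v → (∀ j, u j ≤ v j) → B u ≤ B v) (hL : ∀ k, 0 ≤ L k) (hb : 0 < b)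
    (hlo : ∀ u, SeqBox γ u → b ≤ B u) (hdom : ∀ u, SeqBox γ u → ∑ k ∈ range K, L k * u k ≤ B u)
    (hh : SeqBox γ h) (hf : MemFlow B gIR h)
    (hg : ∀ t, 0 < g t ∧ g t ≤ 1) (hgF : ∀ t, 1 / (1 + ∑ k ∈ range K, L k * h (t + k) ^ 3 / 2) ≤ g t) (hK : 2 ≤ K)
    (hKL : ∀ k n l, KL k n l = if 0 < k ∧ k < K ∧ l < k then L k * h (n + k) ^ 3 / 2 * ∏ t ∈ Ico (n + 1 + l) (n + k + 1), g t else 0) (n : ℕ) :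
    ∑ l ∈ range 1, KL 1 (n + 1) l ≤ ∑ l ∈ range 1, KL 1 n l := by
  rw [sum_range_one, sum_range_one]
  have hdec := kernel_one_lag_decay hmono hL hb hlo hdom hh hf hg hgF hK hKL n
  have h0 := (kernel_one_lag_le_one hmono hL hb hlo hdom hh hf hg hK hKL n).1
  have h1 := (kernel_one_lag_le_one hmono hL hb hlo hdom hh hf hg hK hKL (n + 1)).1
  nlinarith

/-! ## §4 With older ages: MONO″ for the youngest age from KEY and a growth bound of the old surplus -/

/-- **MONO″ FOR THE YOUNGEST AGE, OLDER AGES PRESENT.**  In (E80f)'s letters on the horizon `N ≥ 2`: for an old surplus `v` (`= SA 2 w`) that is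
non-negative, zero-tailed, a SUPERSOLUTION of the one-lag young kernel (KEY₁, from the static chain) and GROWS PER PIN NO FASTER THAN THE ONE-LAG DECAY
RATIO — `KL 1 (n+1) 0·(1 + KL 1 n 0)·v (n+2) ≤ KL 1 n 0·v (n+1)` (for a non-increasing `v` this is (E81b) `kernel_one_lag_decay`) —, the young drops
`m ↦ RL 1 (SL 1 v) m` are NON-INCREASING ((E81a) `young_drops_antitone_of_read_decay` with `U = RL 1 v`). [folklore] -/
theorem flow_mono2_youngest_of_growth {N : ℕ} (hN : 2 ≤ N) {KL : ℕ → ℕ → ℕ → ℝ} {RL SL : ℕ → (ℕ → ℝ) → ℕ → ℝ}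
    (hKL0 : ∀ i m l, 0 ≤ KL i m l) (hKL1 : ∀ m l, 1 ≤ l → KL 1 m l = 0)
    (hRL : ∀ i v m, RL i v m = ∑ l ∈ range N, KL i m l * v (m + 1 + l))
    (hSL : ∀ i (w : ℕ → ℝ), (∀ m, N < m → w m = 0) → (∀ m, N < m → SL i w m = 0) ∧ ∀ m, SL i w m = w m - RL i (SL i w) m)
    {v : ℕ → ℝ} (hv0 : ∀ m, 0 ≤ v m) (hvt : ∀ m, N < m → v m = 0) (hkey : ∀ m, RL 1 v m ≤ v m)
    (hgrow : ∀ n, KL 1 (n + 1) 0 * (1 + KL 1 n 0) * v (n + 2) ≤ KL 1 n 0 * v (n + 1)) :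
    ∀ m, RL 1 (SL 1 v) (m + 1) ≤ RL 1 (SL 1 v) m := by
  obtain ⟨N', rfl⟩ : ∃ N', N = N' + 1 := ⟨N - 1, by omega⟩
  have hRL1 : ∀ u m, RL 1 u m = KL 1 m 0 * u (m + 1) := fun u m => by
    rw [hRL, sum_range_succ', show m + 1 + 0 = m + 1 by ring]
    rw [sum_eq_zero fun l _ => by rw [hKL1 m (l + 1) (by omega), zero_mul], zero_add]
  have hM : ∀ n, (fun n => KL 1 n 0) n = KL 1 n 0 + ∑ l ∈ range (N' + 1 - 1), max (KL 1 n (l + 1) - KL 1 (n + 1) l) 0 := by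
    intro n
    simp only
    rw [sum_eq_zero fun l _ => ?_, add_zero]
    rw [hKL1 n (l + 1) (by omega), max_eq_right]
    linarith [hKL0 1 (n + 1) l]
  refine young_drops_antitone_of_read_decay hRL hKL0 hSL hM hv0 hvt hkey (U := RL 1 v) (fun m => ?_) fun n => ?_
  · have htv := sol_nonneg_le_of_supersol (hRL 1) (hKL0 1) hv0 hkey (hSL 1 v hvt).1 (hSL 1 v hvt).2
    rw [hRL1, hRL1]
    exact mul_le_mul_of_nonneg_left (htv _).2 (hKL0 _ _ _)
  · simp only [hRL1, show n + 1 + 1 = n + 2 by ring]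
    nlinarith [hgrow n]

/-! ## §5 Route (N)'s first-order END for the flow modulo the two static-type families -/

/-- **ROUTE (N), FIRST ORDER, END FOR THE FLOW — MODULO ROW-MASS MONOTONICITY OF THE AGES ≥ 2 AND THE READ-DECAY INEQUALITY.**  As (E80f)
`flow_nonneg_of_mono2`, with its two monotonicity hypotheses replaced by: (a) `hrow` — for every age `2 ≤ k < K` the damped row mass `Σ_l KL k n l` does
not increase with the pin (the age `1` is §3; cumulative domination then by §2); (b) `hdecay` — for every age `i`, every admissible `w`, GIVEN that the old
surplus `v = SA (i+1) w` is non-negative and a supersolution of the young kernel, the young reads `A = RL i v` decay per pin by at least the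
shift-domination defect times the next read: `M i n·A (n+1) ≤ A n − A (n+1)`.  Then the first-order comparison surplus is non-negative. [folklore] -/
theorem flow_nonneg_of_criteria (hmono : ∀ u v : ℕ → ℝ, SeqBox γ u → SeqBox γ v → (∀ j, u j ≤ v j) → B u ≤ B v)
    (hL : ∀ k, 0 ≤ L k) (hb : 0 < b) (hlo : ∀ u, SeqBox γ u → b ≤ B u) (hdom : ∀ u, SeqBox γ u → ∑ k ∈ range K, L k * u k ≤ B u)
    (hh : SeqBox γ h) (hf : MemFlow B gIR h)
    (hg : ∀ t, 0 < g t ∧ g t ≤ 1) (hgF : ∀ t, 1 / (1 + ∑ k ∈ range K, L k * h (t + k) ^ 3 / 2) ≤ g t) (hK : 2 ≤ K)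
    (hKL : ∀ k n l, KL k n l = if 0 < k ∧ k < K ∧ l < k then L k * h (n + k) ^ 3 / 2 * ∏ t ∈ Ico (n + 1 + l) (n + k + 1), g t else 0)
    {θ : ℕ → ℕ → ℕ → ℝ} (hθ : ∀ k n l, θ k n l = 1 - (h (n + k + l) / h (n + k)) ^ 3 * ∏ t ∈ Ico (n + k + 1) (n + k + l + 1), g t)
    {KA : ℕ → ℕ → ℕ → ℝ} {RL RA SL SA : ℕ → (ℕ → ℝ) → ℕ → ℝ}
    (hRL : ∀ i v m, RL i v m = ∑ l ∈ range K, KL i m l * v (m + 1 + l))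
    (hRA : ∀ i v m, RA i v m = ∑ l ∈ range K, KA i m l * v (m + 1 + l))
    (hKA : ∀ i m l, KA i m l = KL i m l + KA (i + 1) m l) (hKAtop : ∀ m l, KA K m l = 0)
    (hSL : ∀ i (w : ℕ → ℝ), (∀ m, K < m → w m = 0) → (∀ m, K < m → SL i w m = 0) ∧ ∀ m, SL i w m = w m - RL i (SL i w) m)
    (hSA : ∀ i (w : ℕ → ℝ), (∀ m, K < m → w m = 0) → (∀ m, K < m → SA i w m = 0) ∧ ∀ m, SA i w m = w m - RA i (SA i w) m)
    (hrow : ∀ k n, 2 ≤ k → k < K → ∑ l ∈ range k, KL k (n + 1) l ≤ ∑ l ∈ range k, KL k n l)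
    {M : ℕ → ℕ → ℝ} (hM : ∀ i n, M i n = KL i n 0 + ∑ l ∈ range (K - 1), max (KL i n (l + 1) - KL i (n + 1) l) 0)
    (hdecay : ∀ i, 1 ≤ i → i ≤ K - 1 → ∀ w : ℕ → ℝ, (∀ m, 0 ≤ w m) → (∀ m, w (m + 1) ≤ w m) → (∀ m, K < m → w m = 0) →
      (∀ m, 0 ≤ SA (i + 1) w m) → (∀ m, RL i (SA (i + 1) w) m ≤ SA (i + 1) w m) →
      ∀ n, M i n * RL i (SA (i + 1) w) (n + 1) ≤ RL i (SA (i + 1) w) n - RL i (SA (i + 1) w) (n + 1))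
    {e ε : ℕ → ℝ} (he0 : ∀ m, 0 ≤ e m) (hea : ∀ m, e (m + 1) ≤ e m) (het : ∀ m, K < m → e m = 0)
    (hεt : ∀ m, K < m → ε m = 0) (hεrec : ∀ m, ε m = e m - RA 1 ε m) : ∀ m, 0 ≤ ε m := by
  have hh0 : ∀ n, 0 < h n := fun n => (hh n).1
  have hanti := (strictAnti_of_memFlow hb hlo hh hf).antitone
  obtain ⟨ρ, β, hρ, hβnew, hβold⟩ := exists_static_chain K KL θ
  have hac := fun n i (hi1 : 1 ≤ i) (hiK : i ≤ K - 1) =>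
    age_chain_closes hmono hL hb hlo hdom hh hf hg hgF hKL hθ hρ hβnew hβold n hi1 hiK
  -- cumulative domination of every lone kernel: age 1 by §3, ages ≥ 2 by `hrow`, both through §2
  have hcumL : ∀ k, 1 ≤ k → k ≤ K - 1 → ∀ m M', ∑ l ∈ range (M' + 1), KL k (m + 1) l ≤ ∑ l ∈ range (M' + 2), KL k m l := by
    intro k hk1 hkK m M'
    refine flow_cum_dom_of_rowmass hL hh0 hanti hg hKL (fun n => ?_) m M'
    rcases Nat.lt_or_ge k 2 with hk2 | hk2
    · have : k = 1 := by omega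
      subst this
      exact flow_rowmass_one hmono hL hb hlo hdom hh hf hg hgF hK hKL n
    · exact hrow k n hk2 (by omega)
  exact nonneg_of_chain_closes_of_read_decay (N := K) (n := K - 1) (y := fun i => i) (KL := KL) (θ := θ)
    (weight_nonneg hL hh0 hg hKL) (weight_eq_zero_of_horizon hKL)
    (fun i m l hl => by rw [hKL, if_neg (fun h3 => by omega)])
    hRL hRA hKA (fun m l => by rw [Nat.sub_add_cancel (by omega : 1 ≤ K)]; exact hKAtop m l) hSL hSA
    (fun i hi1 hiK => ⟨hi1, by omega⟩)
    (defect_nonneg hh0 hanti hg hθ) (persistence hL hh0 hg hKL hθ) (fun k m l l' hll' => defect_mono hh0 hanti hg hθ k m hll')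
    hρ hβnew hβold (fun i m hi1 hiK => (hac m i hi1 hiK).2) (fun i m hi1 hiK => (hac m i hi1 hiK).1) hcumL hM hdecay he0 hea het hεt hεrec

end Summit.QuantumFields.BalabanUV.Beta.EriceRemainderEnclosureHistoryAutonomyComparisonAgeCompositionCriteriaFlow

end
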